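import Mathlib
import Summits.CriticalPhenomena.CardyFormulaZ2.Theorems.CardySelfRefinementGradientComparabilityStubLayerFreeCellTrim
import HarnessLib

/-!
# Boundary-layer surgery, brick (S2) free-cell transfer, part II: the surgery at a free cell

Helper file of the registered stub `stub_layerLocalModification` (deterministic boundary-layer
surgery) of the line `monotone-product-coordinates` (crux `stmt-CriticalPhenomena-10269`,
`…Theses.CardySelfRefinement.GradientComparability`), case (S2): a pivotal axial edge
`e = {p, q}` with a FREE adjacent closed cell `C = {p, q, q', p'}` — the four cell edges drawn
inside `[Q]`, and every lattice edge at a corner drawn off `∂₀Q ∪ ∂₂Q`.  If `Q` is crossed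
inside the drawing of `ρ` but not inside that of `ρ ∖ {e}` (closure semantics, path form), the
entry and exit corners `c_in ≠ c_out` of `freeCell_entryExit` determine the surgery
(`freeCell_surgery`, registered helper): OPEN the arc `S` of the cell boundary from `c_in` to
`c_out` through the rail `{p', q'}` (one of `r`; `f r`; `r g`; `f r g`; `e g r`; `e f r` up to
the reflection `p ↔ q`), CLOSE every other lattice edge at a corner (`Rm` = cell edges and the
lattice edges at the corners other than `c_in`, `c_out`).  Then `Q` is crossed inside the drawing
of `(ρ ∖ Rm) ∪ S` (trimmed links of `c_in`, `c_out` plus the arc) and NOT inside that of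
`(ρ ∖ Rm) ∪ (S ∖ {rail})`: by the three-way decomposition `not_crossing_of_links`, a crossing
would link an end of the `c_in`-side part of the arc to the far side, or an end of the
`c_out`-side part to the near side, or join the two parts — but the inner corners are isolated
and `c_in`, `c_out` have the wrong links (`noCross_route`, `route_template`, `freeCell_route_cases`).
No percolation, no named fact.
-/

noncomputable section

namespace Summit.CriticalPhenomena.CardyFormulaZ2.Theorems.CardySelfRefinement

open scoped Topology
open Filter Set MeasureTheory Metric
open Literature.Probability.LatticeModels Literature.Probability.Percolation
open Literature.Probability.Percolation.QuadCrossing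
open Summit.CriticalPhenomena.CardyFormulaZ2.Theses.CardySelfRefinement

variable {D : Set ℂ} {δ : ℝ}

/-! ## No crossing through a route minus its rail -/

/-- **No crossing through the two halves of a route.**  `τ` does not cross `Q`; `SP`, `SQ` are
edge sets off `τ` with disjoint drawings off `∂₀Q ∪ ∂₂Q`; every end of an edge of `SP` is `xP`
or isolated in `τ`, every end of an edge of `SQ` is `xQ` or isolated; `xP` is not linked in `τ`
to `∂_{jq}Q`, `xQ` not to `∂_{jp}Q`, and the two are not joined.  Then `τ ∪ SP ∪ SQ` does not
cross `Q` (`not_crossing_of_links`). -/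
theorem noCross_route (hδ : 0 < δ) (Q : Quad D) {τ SP SQ : BondConfig (Site 2)} {jp jq : Fin 4}
    (hj : (jp = 0 ∧ jq = 2) ∨ (jp = 2 ∧ jq = 0))
    (hτ : ¬ ∃ a ∈ Q.side 0, ∃ b ∈ Q.side 2, JoinedIn (Q.carrier ∩ openEdgeUnion δ τ) a b)
    {xP xQ : Site 2}
    (hPends : ∀ x x', (zdGraph 2).Adj x x' → s(x, x') ∈ SP →
      x = xP ∨ ∀ y, (zdGraph 2).Adj x y → s(x, y) ∉ τ)
    (hQends : ∀ y y', (zdGraph 2).Adj y y' → s(y, y') ∈ SQ →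
      y = xQ ∨ ∀ y'', (zdGraph 2).Adj y y'' → s(y, y'') ∉ τ)
    (hSP : ∀ ε ∈ SP, ε ∉ τ) (hSQ : ∀ ε ∈ SQ, ε ∉ τ)
    (hAB : ∀ z ∈ openEdgeUnion δ SP, z ∉ openEdgeUnion δ SQ)
    (hbulk : ∀ z ∈ openEdgeUnion δ (SP ∪ SQ), z ∉ Q.side 0 ∧ z ∉ Q.side 2)
    (hxP : ¬ ∃ b ∈ Q.side jq, JoinedIn (Q.carrier ∩ openEdgeUnion δ τ) b (meshPoint δ xP))
    (hxQ : ¬ ∃ a ∈ Q.side jp, JoinedIn (Q.carrier ∩ openEdgeUnion δ τ) a (meshPoint δ xQ))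
    (hPQ : ¬ JoinedIn (Q.carrier ∩ openEdgeUnion δ τ) (meshPoint δ xP) (meshPoint δ xQ)) :
    ¬ ∃ a ∈ Q.side 0, ∃ b ∈ Q.side 2, JoinedIn (Q.carrier ∩ openEdgeUnion δ (τ ∪ SP ∪ SQ)) a b := by
  refine not_crossing_of_links hδ Q hj hτ hSP hSQ hAB hbulk (fun x x' hxx' hx hL => ?_)
    (fun y y' hyy' hy hL => ?_) (fun x x' y y' hxx' hx hyy' hy hJ => ?_)
  · rcases hPends x x' hxx' hx with rfl | hiso
    exacts [hxP hL, not_joinedIn_of_isolated hδ Q hiso _ hL.choose_spec.2]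
  · rcases hQends y y' hyy' hy with rfl | hiso
    exacts [hxQ hL, not_joinedIn_of_isolated hδ Q hiso _ hL.choose_spec.2]
  · rcases hPends x x' hxx' hx with rfl | hiso
    · rcases hQends y y' hyy' hy with rfl | hiso'
      exacts [hPQ hJ, not_joinedIn_of_isolated hδ Q hiso' _ hJ]
    · exact not_joinedIn_of_isolated hδ Q hiso _ hJ.symm

/-- The drawing of a set of lattice edges based at corners misses `∂₀Q ∪ ∂₂Q` when every
lattice edge at a corner is drawn off `∂₀Q ∪ ∂₂Q`. -/
theorem notMem_sides_of_cornerEdges (Q : Quad D) {C : Set (Site 2)} {X : BondConfig (Site 2)}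
    (h02 : ∀ x ∈ C, ∀ y, (zdGraph 2).Adj x y →
      Disjoint (segment ℝ (meshPoint δ x) (meshPoint δ y)) (Q.side 0 ∪ Q.side 2))
    (hX : ∀ ε ∈ X, ∃ x y, ε = s(x, y) ∧ x ∈ C ∧ (zdGraph 2).Adj x y) :
    ∀ z ∈ openEdgeUnion δ X, z ∉ Q.side 0 ∧ z ∉ Q.side 2 := fun z hz => by
  obtain ⟨x', y', -, hε, hzs⟩ := mem_openEdgeUnion_iff.1 hz
  obtain ⟨x, y, heq, hx, hxy⟩ := hX _ hε
  rw [segment_meshPoint_eq_of_sym2_eq δ heq] at hzs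
  have h := Set.disjoint_left.1 (h02 x hx y hxy) hzs
  exact ⟨fun h' => h (Or.inl h'), fun h' => h (Or.inr h')⟩

/-! ## The route template -/

/-- **Route template.**  Corner set `C`; `ρ ∖ σ` consists of cell edges and `σ` does not cross
`Q`; every lattice edge at a corner is drawn off `∂₀Q ∪ ∂₂Q`.  The corner `x₁` is linked to
`∂_{jp}Q` inside the drawing of `ρ` minus the cell edges and the lattice edges at the other
corners, `x₂` likewise to `∂_{jq}Q`; inside the drawing of `σ`, `x₁` is not linked to `∂_{jq}Q`,
`x₂` not to `∂_{jp}Q`, and the two are not joined.  A route `S ∋ rail` of cell edges joins `δx₁`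
to `δx₂` once opened over `ρ ∖ Rm` (`Rm` = cell edges and lattice edges at the corners other
than `x₁, x₂`), and splits off the rail into `SP` (ends `x₁` or other corners) and `SQ` (ends
`x₂` or other corners) with disjoint drawings.  Then: `Rm ∪ S` consists of lattice edges at
corners, contains the cell edges, `S` consists of cell edges and contains the rail, `Q` is
crossed inside the drawing of `(ρ ∖ Rm) ∪ S` and not inside that of `(ρ ∖ Rm) ∪ (S ∖ {rail})`. -/
theorem route_template (hδ : 0 < δ) (Q : Quad D) {p' q' : Site 2} {C : Set (Site 2)}
    {ρ σ : BondConfig (Site 2)}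
    (hρσ : ∀ ε ∈ ρ, ε ∉ σ → ∃ x y, ε = s(x, y) ∧ x ∈ C ∧ y ∈ C ∧ (zdGraph 2).Adj x y)
    (hσ : ¬ ∃ a ∈ Q.side 0, ∃ b ∈ Q.side 2, JoinedIn (Q.carrier ∩ openEdgeUnion δ σ) a b)
    (h02 : ∀ x ∈ C, ∀ y, (zdGraph 2).Adj x y →
      Disjoint (segment ℝ (meshPoint δ x) (meshPoint δ y)) (Q.side 0 ∪ Q.side 2))
    {jp jq : Fin 4} (hj : (jp = 0 ∧ jq = 2) ∨ (jp = 2 ∧ jq = 0)) {x₁ x₂ : Site 2}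
    (h1 : ∃ a ∈ Q.side jp, JoinedIn (Q.carrier ∩ openEdgeUnion δ
      (ρ \ {ε | ∃ x y, ε = s(x, y) ∧ x ∈ C ∧ (zdGraph 2).Adj x y ∧ (y ∈ C ∨ x ≠ x₁)})) a (meshPoint δ x₁))
    (h2 : ∃ b ∈ Q.side jq, JoinedIn (Q.carrier ∩ openEdgeUnion δ
      (ρ \ {ε | ∃ x y, ε = s(x, y) ∧ x ∈ C ∧ (zdGraph 2).Adj x y ∧ (y ∈ C ∨ x ≠ x₂)})) b (meshPoint δ x₂))
    (hn1 : ¬ ∃ b ∈ Q.side jq, JoinedIn (Q.carrier ∩ openEdgeUnion δ σ) b (meshPoint δ x₁))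
    (hn2 : ¬ ∃ a ∈ Q.side jp, JoinedIn (Q.carrier ∩ openEdgeUnion δ σ) a (meshPoint δ x₂))
    (hn12 : ¬ JoinedIn (Q.carrier ∩ openEdgeUnion δ σ) (meshPoint δ x₁) (meshPoint δ x₂))
    {S SP SQ : BondConfig (Site 2)}
    (hS : ∀ ε ∈ S, ∃ x y, ε = s(x, y) ∧ x ∈ C ∧ y ∈ C ∧ (zdGraph 2).Adj x y)
    (hrS : s(p', q') ∈ S) (hSsplit : ∀ ε ∈ S, ε ≠ s(p', q') → ε ∈ SP ∨ ε ∈ SQ)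
    (hSPS : SP ⊆ S) (hSQS : SQ ⊆ S)
    (h12S : JoinedIn (Q.carrier ∩ openEdgeUnion δ
      ((ρ \ {ε | ∃ x y, ε = s(x, y) ∧ x ∈ C ∧ (zdGraph 2).Adj x y ∧ (y ∈ C ∨ (x ≠ x₁ ∧ x ≠ x₂))}) ∪ S))
      (meshPoint δ x₁) (meshPoint δ x₂))
    (hPends : ∀ x x', (zdGraph 2).Adj x x' → s(x, x') ∈ SP → x = x₁ ∨ (x ∈ C ∧ x ≠ x₁ ∧ x ≠ x₂))
    (hQends : ∀ y y', (zdGraph 2).Adj y y' → s(y, y') ∈ SQ → y = x₂ ∨ (y ∈ C ∧ y ≠ x₁ ∧ y ≠ x₂))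
    (hAB : ∀ z ∈ openEdgeUnion δ SP, z ∉ openEdgeUnion δ SQ) :
    ∃ (Rm S : Set (Sym2 (Site 2))),
      (∀ ε ∈ Rm ∪ S, ∃ x y, ε = s(x, y) ∧ x ∈ C ∧ (zdGraph 2).Adj x y) ∧
      (∀ x ∈ C, ∀ y ∈ C, (zdGraph 2).Adj x y → s(x, y) ∈ Rm) ∧
      (∀ ε ∈ S, ∃ x y, ε = s(x, y) ∧ x ∈ C ∧ y ∈ C ∧ (zdGraph 2).Adj x y) ∧
      s(p', q') ∈ S ∧
      (∃ K, Q.IsCrossing K ∧ K ⊆ openEdgeUnion δ ((ρ \ Rm) ∪ S)) ∧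
      ¬ ∃ K, Q.IsCrossing K ∧ K ⊆ openEdgeUnion δ ((ρ \ Rm) ∪ (S \ {s(p', q')})) := by
  set Rm : Set (Sym2 (Site 2)) :=
    {ε | ∃ x y, ε = s(x, y) ∧ x ∈ C ∧ (zdGraph 2).Adj x y ∧ (y ∈ C ∨ (x ≠ x₁ ∧ x ≠ x₂))} with hRm
  set τ : BondConfig (Site 2) := ρ \ Rm with hτdef
  have hcellRm : ∀ x ∈ C, ∀ y ∈ C, (zdGraph 2).Adj x y → s(x, y) ∈ Rm :=
    fun x hx y hy hxy => ⟨x, y, rfl, hx, hxy, Or.inl hy⟩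
  have hτσ : τ ⊆ σ := fun ε hε => by
    by_contra h
    obtain ⟨x, y, rfl, hx, hy, hxy⟩ := hρσ ε hε.1 h
    exact hε.2 (hcellRm x hx y hy hxy)
  have hτ : ¬ ∃ a ∈ Q.side 0, ∃ b ∈ Q.side 2, JoinedIn (Q.carrier ∩ openEdgeUnion δ τ) a b :=
    fun ⟨a, ha, b, hb, hJ⟩ => hσ ⟨a, ha, b, hb, joinedIn_mono_config δ Q hτσ hJ⟩
  have hSRm : ∀ ε ∈ S, ε ∈ Rm := fun ε hε => by
    obtain ⟨x, y, rfl, hx, hy, hxy⟩ := hS ε hε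
    exact hcellRm x hx y hy hxy
  refine ⟨Rm, S, ?_, hcellRm, hS, hrS, ?_, ?_⟩
  · rintro ε (⟨x, y, h, hx, hxy, -⟩ | hε)
    · exact ⟨x, y, h, hx, hxy⟩
    · obtain ⟨x, y, h, hx, -, hxy⟩ := hS ε hε
      exact ⟨x, y, h, hx, hxy⟩
  · -- the new crossing
    have hsub1 : ρ \ {ε | ∃ x y, ε = s(x, y) ∧ x ∈ C ∧ (zdGraph 2).Adj x y ∧ (y ∈ C ∨ x ≠ x₁)} ⊆ τ ∪ S :=
      fun ε hε => Or.inl ⟨hε.1, fun ⟨x, y, h, hx, hxy, hor⟩ =>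
        hε.2 ⟨x, y, h, hx, hxy, hor.imp_right And.left⟩⟩
    have hsub2 : ρ \ {ε | ∃ x y, ε = s(x, y) ∧ x ∈ C ∧ (zdGraph 2).Adj x y ∧ (y ∈ C ∨ x ≠ x₂)} ⊆ τ ∪ S :=
      fun ε hε => Or.inl ⟨hε.1, fun ⟨x, y, h, hx, hxy, hor⟩ =>
        hε.2 ⟨x, y, h, hx, hxy, hor.imp_right And.right⟩⟩
    exact (exists_isCrossing_iff_joinedIn hδ Q _).2 (crossing_of_two_links Q hj (link_mono δ Q hsub1 h1)
      (link_of_joinedIn (link_mono δ Q hsub2 h2) h12S.symm))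
  · -- no crossing without the rail
    intro hK
    obtain ⟨a, ha, b, hb, hJ⟩ := (exists_isCrossing_iff_joinedIn hδ Q _).1 hK
    have hcont : (ρ \ Rm) ∪ (S \ {s(p', q')}) ⊆ τ ∪ SP ∪ SQ := by
      rintro ε (hε | ⟨hεS, hne⟩)
      · exact Or.inl (Or.inl hε)
      · rcases hSsplit ε hεS hne with h | h
        exacts [Or.inl (Or.inr h), Or.inr h]
    have hiso : ∀ x ∈ C, x ≠ x₁ → x ≠ x₂ → ∀ y, (zdGraph 2).Adj x y → s(x, y) ∉ τ :=
      fun x hx h₁ h₂ y hy h => h.2 ⟨x, y, rfl, hx, hy, Or.inr ⟨h₁, h₂⟩⟩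
    refine noCross_route hδ Q hj hτ (xP := x₁) (xQ := x₂) (fun x x' hxx' hx => ?_) (fun y y' hyy' hy => ?_)
      (fun ε hε h => h.2 (hSRm ε (hSPS hε))) (fun ε hε h => h.2 (hSRm ε (hSQS hε))) hAB
      (notMem_sides_of_cornerEdges Q h02 fun ε hε => ?_)
      (fun h => hn1 (link_mono δ Q hτσ h)) (fun h => hn2 (link_mono δ Q hτσ h))
      (fun h => hn12 (joinedIn_mono_config δ Q hτσ h))
      ⟨a, ha, b, hb, joinedIn_mono_config δ Q hcont hJ⟩
    · exact (hPends x x' hxx' hx).imp_right fun h => hiso x h.1 h.2.1 h.2.2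
    · exact (hQends y y' hyy' hy).imp_right fun h => hiso y h.1 h.2.1 h.2.2
    · have hεS : ε ∈ S := hε.elim (fun h => hSPS h) (fun h => hSQS h)
      obtain ⟨x, y, h, hx, -, hxy⟩ := hS ε hεS
      exact ⟨x, y, h, hx, hxy⟩

/-! ## The four route types -/

/-- **The four route types** (up to reflection and exchange of the two sides).  Case A
(`x₁ = p`, `x₂ = q`): route `f r g`, `SP = {f}`, `SQ = {g}`; case B (`x₁ = p'`, `x₂ = q'`):
route `r`; case C (`x₁ = p`, `x₂ = q'`): route `f r`, `SP = {f}`; case D (`x₁ = p`, `x₂ = p'`):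
route `e g r` through `q`, `q'` (the pivotal edge `e` stays open), `SP = {e, g}`.  In each case
the hypotheses of `route_template` are checked from the adjacencies and distinctness of the four
corners. -/
theorem freeCell_route_cases (hδ : 0 < δ) (Q : Quad D) {p q p' q' : Site 2} {C : Set (Site 2)}
    (hC : ∀ x, x ∈ C ↔ x = p ∨ x = q ∨ x = p' ∨ x = q')
    (hpq : (zdGraph 2).Adj p q) (hpp' : (zdGraph 2).Adj p p') (hp'q' : (zdGraph 2).Adj p' q')
    (hq'q : (zdGraph 2).Adj q' q) (hpq' : p ≠ q') (hp'q : p' ≠ q) {ρ σ : BondConfig (Site 2)}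
    (hρσ : ∀ ε ∈ ρ, ε ∉ σ → ∃ x y, ε = s(x, y) ∧ x ∈ C ∧ y ∈ C ∧ (zdGraph 2).Adj x y)
    (hσ : ¬ ∃ a ∈ Q.side 0, ∃ b ∈ Q.side 2, JoinedIn (Q.carrier ∩ openEdgeUnion δ σ) a b)
    (hcellQ : ∀ x ∈ C, ∀ y ∈ C, (zdGraph 2).Adj x y →
      segment ℝ (meshPoint δ x) (meshPoint δ y) ⊆ Q.carrier)
    (h02 : ∀ x ∈ C, ∀ y, (zdGraph 2).Adj x y →
      Disjoint (segment ℝ (meshPoint δ x) (meshPoint δ y)) (Q.side 0 ∪ Q.side 2))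
    {jp jq : Fin 4} (hj : (jp = 0 ∧ jq = 2) ∨ (jp = 2 ∧ jq = 0)) {x₁ x₂ : Site 2}
    (hcase : (x₁ = p ∧ x₂ = q) ∨ (x₁ = p' ∧ x₂ = q') ∨ (x₁ = p ∧ x₂ = q') ∨ (x₁ = p ∧ x₂ = p'))
    (h1 : ∃ a ∈ Q.side jp, JoinedIn (Q.carrier ∩ openEdgeUnion δ
      (ρ \ {ε | ∃ x y, ε = s(x, y) ∧ x ∈ C ∧ (zdGraph 2).Adj x y ∧ (y ∈ C ∨ x ≠ x₁)})) a (meshPoint δ x₁))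
    (h2 : ∃ b ∈ Q.side jq, JoinedIn (Q.carrier ∩ openEdgeUnion δ
      (ρ \ {ε | ∃ x y, ε = s(x, y) ∧ x ∈ C ∧ (zdGraph 2).Adj x y ∧ (y ∈ C ∨ x ≠ x₂)})) b (meshPoint δ x₂))
    (hn1 : ¬ ∃ b ∈ Q.side jq, JoinedIn (Q.carrier ∩ openEdgeUnion δ σ) b (meshPoint δ x₁))
    (hn2 : ¬ ∃ a ∈ Q.side jp, JoinedIn (Q.carrier ∩ openEdgeUnion δ σ) a (meshPoint δ x₂))
    (hn12 : ¬ JoinedIn (Q.carrier ∩ openEdgeUnion δ σ) (meshPoint δ x₁) (meshPoint δ x₂)) :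
    ∃ (Rm S : Set (Sym2 (Site 2))),
      (∀ ε ∈ Rm ∪ S, ∃ x y, ε = s(x, y) ∧ x ∈ C ∧ (zdGraph 2).Adj x y) ∧
      (∀ x ∈ C, ∀ y ∈ C, (zdGraph 2).Adj x y → s(x, y) ∈ Rm) ∧
      (∀ ε ∈ S, ∃ x y, ε = s(x, y) ∧ x ∈ C ∧ y ∈ C ∧ (zdGraph 2).Adj x y) ∧
      s(p', q') ∈ S ∧
      (∃ K, Q.IsCrossing K ∧ K ⊆ openEdgeUnion δ ((ρ \ Rm) ∪ S)) ∧
      ¬ ∃ K, Q.IsCrossing K ∧ K ⊆ openEdgeUnion δ ((ρ \ Rm) ∪ (S \ {s(p', q')})) := by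
  have hpC : p ∈ C := (hC p).2 (Or.inl rfl)
  have hqC : q ∈ C := (hC q).2 (Or.inr (Or.inl rfl))
  have hp'C : p' ∈ C := (hC p').2 (Or.inr (Or.inr (Or.inl rfl)))
  have hq'C : q' ∈ C := (hC q').2 (Or.inr (Or.inr (Or.inr rfl)))
  have hemp : ∀ z, z ∉ openEdgeUnion δ (∅ : BondConfig (Site 2)) := fun z hz => by
    obtain ⟨x, y, -, h, -⟩ := mem_openEdgeUnion_iff.1 hz
    exact h
  -- the drawn cell edges join their ends inside `[Q]` once opened
  have hJ : ∀ {x y : Site 2} {ω : BondConfig (Site 2)}, x ∈ C → y ∈ C → (zdGraph 2).Adj x y →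
      s(x, y) ∈ ω → JoinedIn (Q.carrier ∩ openEdgeUnion δ ω) (meshPoint δ x) (meshPoint δ y) :=
    fun hx hy hxy h => joinedIn_of_adj_mem δ Q hxy h (hcellQ _ hx _ hy hxy)
  rcases hcase with ⟨rfl, rfl⟩ | ⟨rfl, rfl⟩ | ⟨rfl, rfl⟩ | ⟨rfl, rfl⟩
  · -- case A
    refine route_template hδ Q hρσ hσ h02 hj h1 h2 hn1 hn2 hn12
      (S := {s(x₁, p'), s(p', q'), s(q', x₂)}) (SP := {s(x₁, p')}) (SQ := {s(q', x₂)}) ?_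
      (Or.inr (Or.inl rfl)) ?_ (fun ε h => Or.inl h) (fun ε h => Or.inr (Or.inr h)) ?_ ?_ ?_ ?_
    · rintro ε (rfl | rfl | rfl)
      exacts [⟨_, p', rfl, hpC, hp'C, hpp'⟩, ⟨p', q', rfl, hp'C, hq'C, hp'q'⟩, ⟨q', _, rfl, hq'C, hqC, hq'q⟩]
    · rintro ε (rfl | rfl | rfl) hne
      exacts [Or.inl rfl, absurd rfl hne, Or.inr rfl]
    · exact ((hJ hpC hp'C hpp' (Or.inr (Or.inl rfl))).trans
        (hJ hp'C hq'C hp'q' (Or.inr (Or.inr (Or.inl rfl))))).trans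
        (hJ hq'C hqC hq'q (Or.inr (Or.inr (Or.inr rfl))))
    · intro x x' _ hx
      rcases eq_or_eq_of_sym2_eq (Set.mem_singleton_iff.1 hx) with rfl | rfl
      exacts [Or.inl rfl, Or.inr ⟨hp'C, hpp'.ne.symm, hp'q⟩]
    · intro y y' _ hy
      rcases eq_or_eq_of_sym2_eq (Set.mem_singleton_iff.1 hy) with rfl | rfl
      exacts [Or.inr ⟨hq'C, hpq'.symm, hq'q.ne⟩, Or.inl rfl]
    · intro z hz hz'
      exact segment_disjoint_of_ne hδ.ne' hpp' hq'q hpq' hpq.ne hp'q'.ne hp'q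
        (openEdgeUnion_singleton_subset δ _ p' hz) (openEdgeUnion_singleton_subset δ q' _ hz')
  · -- case B
    refine route_template hδ Q hρσ hσ h02 hj h1 h2 hn1 hn2 hn12
      (S := {s(x₁, x₂)}) (SP := ∅) (SQ := ∅) ?_ rfl (fun ε h hne => absurd h hne)
      (Set.empty_subset _) (Set.empty_subset _) (hJ hp'C hq'C hp'q' (Or.inr rfl))
      (fun x x' _ hx => absurd hx (Set.notMem_empty _))
      (fun y y' _ hy => absurd hy (Set.notMem_empty _)) (fun z hz _ => hemp z hz)
    intro ε h
    rw [Set.mem_singleton_iff.1 h]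
    exact ⟨_, _, rfl, hp'C, hq'C, hp'q'⟩
  · -- case C
    refine route_template hδ Q hρσ hσ h02 hj h1 h2 hn1 hn2 hn12
      (S := {s(x₁, p'), s(p', x₂)}) (SP := {s(x₁, p')}) (SQ := ∅) ?_ (Or.inr rfl) ?_
      (fun ε h => Or.inl h) (Set.empty_subset _) ?_ ?_
      (fun y y' _ hy => absurd hy (Set.notMem_empty _)) (fun z _ hz' => hemp z hz')
    · rintro ε (rfl | rfl)
      exacts [⟨_, p', rfl, hpC, hp'C, hpp'⟩, ⟨p', _, rfl, hp'C, hq'C, hp'q'⟩]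
    · rintro ε (rfl | rfl) hne
      exacts [Or.inl rfl, absurd rfl hne]
    · exact (hJ hpC hp'C hpp' (Or.inr (Or.inl rfl))).trans (hJ hp'C hq'C hp'q' (Or.inr (Or.inr rfl)))
    · intro x x' _ hx
      rcases eq_or_eq_of_sym2_eq (Set.mem_singleton_iff.1 hx) with rfl | rfl
      exacts [Or.inl rfl, Or.inr ⟨hp'C, hpp'.ne.symm, hp'q'.ne⟩]
  · -- case D
    refine route_template hδ Q hρσ hσ h02 hj h1 h2 hn1 hn2 hn12
      (S := {s(x₁, q), s(q', q), s(x₂, q')}) (SP := {s(x₁, q), s(q', q)}) (SQ := ∅) ?_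
      (Or.inr (Or.inr rfl)) ?_ (fun ε h => h.elim (fun h => Or.inl h) (fun h => Or.inr (Or.inl h)))
      (Set.empty_subset _) ?_ ?_ (fun y y' _ hy => absurd hy (Set.notMem_empty _))
      (fun z _ hz' => hemp z hz')
    · rintro ε (rfl | rfl | rfl)
      exacts [⟨_, q, rfl, hpC, hqC, hpq⟩, ⟨q', q, rfl, hq'C, hqC, hq'q⟩, ⟨_, q', rfl, hp'C, hq'C, hp'q'⟩]
    · rintro ε (rfl | rfl | rfl) hne
      exacts [Or.inl (Or.inl rfl), Or.inl (Or.inr rfl), absurd rfl hne]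
    · exact ((hJ hpC hqC hpq (Or.inr (Or.inl rfl))).trans
        (hJ hq'C hqC hq'q (Or.inr (Or.inr (Or.inl rfl)))).symm).trans
        (hJ hp'C hq'C hp'q' (Or.inr (Or.inr (Or.inr rfl)))).symm
    · intro x x' _ hx
      rcases hx with hx | hx
      · rcases eq_or_eq_of_sym2_eq hx with rfl | rfl
        exacts [Or.inl rfl, Or.inr ⟨hqC, hpq.ne.symm, hp'q.symm⟩]
      · rcases eq_or_eq_of_sym2_eq (Set.mem_singleton_iff.1 hx) with rfl | rfl
        exacts [Or.inr ⟨hq'C, hpq'.symm, hp'q'.ne.symm⟩, Or.inr ⟨hqC, hpq.ne.symm, hp'q.symm⟩]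

/-! ## The surgery at a free cell -/

/-- **Free-cell surgery** (registered helper).  Corner set `C = {p, q, p', q'}` of a closed
lattice cell (`p ∼ q`, `p ∼ p'`, `p' ∼ q'`, `q' ∼ q`, `p ≠ q'`, `p' ≠ q`) whose four edges are
drawn inside `[Q]`, every lattice edge at a corner drawn off `∂₀Q ∪ ∂₂Q`; `Q` crossed inside the
drawing of `ρ` but not inside that of `ρ ∖ {{p, q}}`.  Then there are sets `Rm` (cell edges and
lattice edges at corners) and `S ∋ {p', q'}` (cell edges) with `Q` crossed inside the drawing of
`(ρ ∖ Rm) ∪ S` and not inside that of `(ρ ∖ Rm) ∪ (S ∖ {{p', q'}})`: dispatch on the entry and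
exit corners of `freeCell_entryExit` to the four route types, up to the reflection `p ↔ q`,
`p' ↔ q'` and the exchange of `∂₀Q`, `∂₂Q`. -/
theorem freeCell_surgery : ∀ {D : Set ℂ} {δ : ℝ}, 0 < δ → ∀ (Q : Quad D) (p q p' q' : Site 2) (C : Set (Site 2)) (ρ : BondConfig (Site 2)), (∀ x, x ∈ C ↔ x = p ∨ x = q ∨ x = p' ∨ x = q') → (zdGraph 2).Adj p q → (zdGraph 2).Adj p p' → (zdGraph 2).Adj p' q' → (zdGraph 2).Adj q' q → p ≠ q' → p' ≠ q → (∃ K, Q.IsCrossing K ∧ K ⊆ openEdgeUnion δ ρ) → (¬ ∃ K, Q.IsCrossing K ∧ K ⊆ openEdgeUnion δ (ρ \ {s(p, q)})) → (∀ x ∈ C, ∀ y ∈ C, (zdGraph 2).Adj x y → segment ℝ (meshPoint δ x) (meshPoint δ y) ⊆ Q.carrier) → (∀ x ∈ C, ∀ y, (zdGraph 2).Adj x y → Disjoint (segment ℝ (meshPoint δ x) (meshPoint δ y)) (Q.side 0 ∪ Q.side 2)) → ∃ (Rm S : Set (Sym2 (Site 2))), (∀ ε ∈ Rm ∪ S,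 ∃ x y, ε = s(x, y) ∧ x ∈ C ∧ (zdGraph 2).Adj x y) ∧ (∀ x ∈ C, ∀ y ∈ C, (zdGraph 2).Adj x y → s(x, y) ∈ Rm) ∧ (∀ ε ∈ S, ∃ x y, ε = s(x, y) ∧ x ∈ C ∧ y ∈ C ∧ (zdGraph 2).Adj x y) ∧ s(p', q') ∈ S ∧ (∃ K, Q.IsCrossing K ∧ K ⊆ openEdgeUnion δ ((ρ \ Rm) ∪ S)) ∧ ¬ ∃ K, Q.IsCrossing K ∧ K ⊆ openEdgeUnion δ ((ρ \ Rm) ∪ (S \ {s(p', q')})) := by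
  intro D δ hδ Q p q p' q' C ρ hC hpq hpp' hp'q' hq'q hpq' hp'q hcr hσ hcellQ h02
  have hpC : p ∈ C := (hC p).2 (Or.inl rfl)
  have hqC : q ∈ C := (hC q).2 (Or.inr (Or.inl rfl))
  have hC' : ∀ x, x ∈ C ↔ x = q ∨ x = p ∨ x = q' ∨ x = p' := fun x => by rw [hC x]; tauto
  rw [exists_isCrossing_iff_joinedIn hδ] at hcr hσ
  have hρσ : ∀ ε ∈ ρ, ε ∉ ρ \ {s(p, q)} → ∃ x y, ε = s(x, y) ∧ x ∈ C ∧ y ∈ C ∧ (zdGraph 2).Adj x y :=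
    fun ε hε h => ⟨p, q, by simpa using (not_and.1 h) hε, hpC, hqC, hpq⟩
  obtain ⟨cin, hcin, cout, hcout, hne, L1, L2, n1, n2, n12⟩ :=
    freeCell_entryExit hδ Q p q p' q' C ρ hC hpq hp'q' hcr hσ h02
  have n21 : ¬ JoinedIn (Q.carrier ∩ openEdgeUnion δ (ρ \ {s(p, q)})) (meshPoint δ cout) (meshPoint δ cin) :=
    fun h => n12 h.symm
  have h02' : (0 : Fin 4) = 0 ∧ (2 : Fin 4) = 2 := ⟨rfl, rfl⟩
  have hswap : (∃ (Rm S : Set (Sym2 (Site 2))),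
      (∀ ε ∈ Rm ∪ S, ∃ x y, ε = s(x, y) ∧ x ∈ C ∧ (zdGraph 2).Adj x y) ∧
        (∀ x ∈ C, ∀ y ∈ C, (zdGraph 2).Adj x y → s(x, y) ∈ Rm) ∧
        (∀ ε ∈ S, ∃ x y, ε = s(x, y) ∧ x ∈ C ∧ y ∈ C ∧ (zdGraph 2).Adj x y) ∧ s(q', p') ∈ S ∧
        (∃ K, Q.IsCrossing K ∧ K ⊆ openEdgeUnion δ ((ρ \ Rm) ∪ S)) ∧
        ¬ ∃ K, Q.IsCrossing K ∧ K ⊆ openEdgeUnion δ ((ρ \ Rm) ∪ (S \ {s(q', p')}))) →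
      ∃ (Rm S : Set (Sym2 (Site 2))), (∀ ε ∈ Rm ∪ S, ∃ x y, ε = s(x, y) ∧ x ∈ C ∧ (zdGraph 2).Adj x y) ∧
        (∀ x ∈ C, ∀ y ∈ C, (zdGraph 2).Adj x y → s(x, y) ∈ Rm) ∧
        (∀ ε ∈ S, ∃ x y, ε = s(x, y) ∧ x ∈ C ∧ y ∈ C ∧ (zdGraph 2).Adj x y) ∧ s(p', q') ∈ S ∧
        (∃ K, Q.IsCrossing K ∧ K ⊆ openEdgeUnion δ ((ρ \ Rm) ∪ S)) ∧
        ¬ ∃ K, Q.IsCrossing K ∧ K ⊆ openEdgeUnion δ ((ρ \ Rm) ∪ (S \ {s(p', q')})) :=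
    fun h => by rw [Sym2.eq_swap (a := p')]; exact h
  rcases (hC cin).1 hcin with h1 | h1 | h1 | h1 <;>
    rcases (hC cout).1 hcout with h2 | h2 | h2 | h2 <;>
    rw [h1] at L1 n1 n12 n21 hne <;> rw [h2] at L2 n2 n12 n21 hne
  · exact absurd rfl hne
  · exact freeCell_route_cases hδ Q hC hpq hpp' hp'q' hq'q hpq' hp'q hρσ hσ hcellQ h02 (Or.inl h02')
      (Or.inl ⟨rfl, rfl⟩) L1 L2 n1 n2 n12
  · exact freeCell_route_cases hδ Q hC hpq hpp' hp'q' hq'q hpq' hp'q hρσ hσ hcellQ h02 (Or.inl h02')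
      (Or.inr (Or.inr (Or.inr ⟨rfl, rfl⟩))) L1 L2 n1 n2 n12
  · exact freeCell_route_cases hδ Q hC hpq hpp' hp'q' hq'q hpq' hp'q hρσ hσ hcellQ h02 (Or.inl h02')
      (Or.inr (Or.inr (Or.inl ⟨rfl, rfl⟩))) L1 L2 n1 n2 n12
  · exact freeCell_route_cases hδ Q hC hpq hpp' hp'q' hq'q hpq' hp'q hρσ hσ hcellQ h02 (Or.inr h02'.symm)
      (Or.inl ⟨rfl, rfl⟩) L2 L1 n2 n1 n21
  · exact absurd rfl hne
  · exact hswap (freeCell_route_cases hδ Q hC' hpq.symm hq'q.symm hp'q'.symm hpp'.symm hp'q.symm hpq'.symm hρσ hσ hcellQ h02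
      (Or.inl h02') (Or.inr (Or.inr (Or.inl ⟨rfl, rfl⟩))) L1 L2 n1 n2 n12)
  · exact hswap (freeCell_route_cases hδ Q hC' hpq.symm hq'q.symm hp'q'.symm hpp'.symm hp'q.symm hpq'.symm hρσ hσ hcellQ h02
      (Or.inl h02') (Or.inr (Or.inr (Or.inr ⟨rfl, rfl⟩))) L1 L2 n1 n2 n12)
  · exact freeCell_route_cases hδ Q hC hpq hpp' hp'q' hq'q hpq' hp'q hρσ hσ hcellQ h02 (Or.inr h02'.symm)
      (Or.inr (Or.inr (Or.inr ⟨rfl, rfl⟩))) L2 L1 n2 n1 n21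
  · exact hswap (freeCell_route_cases hδ Q hC' hpq.symm hq'q.symm hp'q'.symm hpp'.symm hp'q.symm hpq'.symm hρσ hσ hcellQ h02
      (Or.inr h02'.symm) (Or.inr (Or.inr (Or.inl ⟨rfl, rfl⟩))) L2 L1 n2 n1 n21)
  · exact absurd rfl hne
  · exact freeCell_route_cases hδ Q hC hpq hpp' hp'q' hq'q hpq' hp'q hρσ hσ hcellQ h02 (Or.inl h02')
      (Or.inr (Or.inl ⟨rfl, rfl⟩)) L1 L2 n1 n2 n12
  · exact freeCell_route_cases hδ Q hC hpq hpp' hp'q' hq'q hpq' hp'q hρσ hσ hcellQ h02 (Or.inr h02'.symm)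
      (Or.inr (Or.inr (Or.inl ⟨rfl, rfl⟩))) L2 L1 n2 n1 n21
  · exact hswap (freeCell_route_cases hδ Q hC' hpq.symm hq'q.symm hp'q'.symm hpp'.symm hp'q.symm hpq'.symm hρσ hσ hcellQ h02
      (Or.inr h02'.symm) (Or.inr (Or.inr (Or.inr ⟨rfl, rfl⟩))) L2 L1 n2 n1 n21)
  · exact freeCell_route_cases hδ Q hC hpq hpp' hp'q' hq'q hpq' hp'q hρσ hσ hcellQ h02 (Or.inr h02'.symm)
      (Or.inr (Or.inl ⟨rfl, rfl⟩)) L2 L1 n2 n1 n21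
  · exact absurd rfl hne

end Summit.CriticalPhenomena.CardyFormulaZ2.Theorems.CardySelfRefinement

end
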